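import Summits.NavierStokesRegularity.NavierStokesRegularity.Theorems.IsotropicBlobDefs
import Summits.NavierStokesRegularity.NavierStokesRegularity.Theorems.HarmonicShellRadial
import Summits.NavierStokesRegularity.NavierStokesRegularity.Theorems.HarmonicShellZonal
import Mathlib.Analysis.Normed.Group.Bounded
import HarnessLib

/-!
# IsotropicBlobPressureAssembly — plate W2 (abstract) of ROUND-41 «IsotropicBlobPressureLaw» (S-door lane):
# the ZONAL PRESSURE `p = Φ₀(‖x‖²) + Φ₂(‖x‖²)Z₂ + Φ₄(‖x‖²)Z₄` is THE decaying pressure of a field `u`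
# as soon as the three 1-D Poisson identities and the trace identity hold

For `C²` profiles `Φ₀ Φ₂ Φ₄ : ℝ → ℝ`:
* `zonalPressure Φ₀ Φ₂ Φ₄ x := Φ₀(‖x‖²) + Φ₂(‖x‖²)·Z₂(x) + Φ₄(‖x‖²)·Z₄(x)` (`Z_l = polyFun zonal_l`, plate Z);
* `contDiff_two_zonalPressure`; `laplacian_zonalPressure`:
  `Δp(x) = (4sΦ₀″+6Φ₀′) + (4sΦ₂″+14Φ₂′)·Z₂(x) + (4sΦ₄″+22Φ₄′)·Z₄(x)`, `s = ‖x‖²`, at EVERY `x` (plate R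
  `HarmonicShell.laplacian_radial_mul` ×3, harmonicity + Euler of `Z_l` from plate Z);
* `tendsto_zonalPressure_cocompact`: decay from `|Φ₀| ≤ C/√s`, `|Φ₂|·s ≤ C/√s`, `|Φ₄|·s² ≤ C/√s` on `s ≥ 1`;
* `isDecayingPressureOf_zonalPressure`: with the 1-D Poisson identities `4sΦ_l″ + (4l+6)Φ_l′ = F_l` on `s ≥ 0` and
  the trace identity `−tr((∇u)²)(x) = F₀(‖x‖²) + F₂(‖x‖²)Z₂(x) + F₄(‖x‖²)Z₄(x)`, `p` is `IsDecayingPressureOf u p`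
  (Sketch45/`IsotropicBlobDefs`, verbatim), hence THE decaying pressure by `IsotropicBlobPoissonUnique` (plate E3).

Instantiation (ROUND-41 `C²` witness, nsreg-p1 g33 «Glue1D»): Φ_l = the glued profiles of r41/glue1d_k4.txt
(`IsotropicBlobPressureProfiles`, ns-s29-p2), F_l = `srcProfile_l` (`IsotropicBlobSourceProfiles`), u = `witnessFieldC2`
(trace identity: `IsotropicBlobWitnessField…`, ns-sfl-p1).  `--supports stmt-NavierStokesRegularity-0056 --as helper`.
HONEST FRAME: calculus bookkeeping for a kinematic slice witness; 0056 `NoTypeII` / NS regularity NOT proved.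
-/

set_option linter.dupNamespace false

open Set Function Filter Topology InnerProductSpace
open scoped RealInnerProductSpace Laplacian ContDiff

namespace Summit.NavierStokesRegularity.NavierStokesRegularity.Theorems.StrainDoors

namespace IsotropicBlob

open HarmonicShell Literature.Analysis Literature.Analysis.FluidPDE

noncomputable section

/-- support (definition): the ZONAL PRESSURE with radial profiles `Φ₀, Φ₂, Φ₄` of `s = ‖x‖²`:
`p(x) = Φ₀(s) + Φ₂(s)·Z₂(x) + Φ₄(s)·Z₄(x)`. -/
def zonalPressure (Φ₀ Φ₂ Φ₄ : ℝ → ℝ) (x : EuclideanSpace ℝ (Fin 3)) : ℝ :=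
  Φ₀ (‖x‖ ^ 2) + Φ₂ (‖x‖ ^ 2) * polyFun zonal2 x + Φ₄ (‖x‖ ^ 2) * polyFun zonal4 x

variable {Φ₀ Φ₂ Φ₄ : ℝ → ℝ}

/-- The three summands of the zonal pressure. -/
theorem zonalPressure_eq (Φ₀ Φ₂ Φ₄ : ℝ → ℝ) :
    zonalPressure Φ₀ Φ₂ Φ₄ =
      (fun x => Φ₀ (‖x‖ ^ 2) * (fun _ => (1 : ℝ)) x) + (fun x => Φ₂ (‖x‖ ^ 2) * polyFun zonal2 x)
        + fun x => Φ₄ (‖x‖ ^ 2) * polyFun zonal4 x := by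
  funext x
  simp only [zonalPressure, Pi.add_apply, mul_one]

/-- A `C²` radial profile gives a `C²` radial function, `C²` at every point (at `‖x‖²`). -/
theorem contDiffAt_profile {Φ : ℝ → ℝ} (h : ContDiff ℝ 2 Φ) (x : EuclideanSpace ℝ (Fin 3)) :
    ContDiffAt ℝ 2 Φ (‖x‖ ^ 2) :=
  h.contDiffAt

/-- **The zonal pressure is `C²`** for `C²` profiles. -/
theorem contDiff_two_zonalPressure (h0 : ContDiff ℝ 2 Φ₀) (h2 : ContDiff ℝ 2 Φ₂) (h4 : ContDiff ℝ 2 Φ₄) :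
    ContDiff ℝ 2 (zonalPressure Φ₀ Φ₂ Φ₄) := by
  rw [zonalPressure_eq]
  exact (((h0.comp (contDiff_norm_sq ℝ)).mul contDiff_const).add
    ((h2.comp (contDiff_norm_sq ℝ)).mul contDiff_zonal2)).add ((h4.comp (contDiff_norm_sq ℝ)).mul contDiff_zonal4)

/-- **The Laplacian of the zonal pressure, at every point** (plate R ×3 + plate Z):
`Δp(x) = (4sΦ₀″+6Φ₀′) + (4sΦ₂″+14Φ₂′)Z₂(x) + (4sΦ₄″+22Φ₄′)Z₄(x)`, `s = ‖x‖²` (profiles' derivatives at `s`). -/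
theorem laplacian_zonalPressure (h0 : ContDiff ℝ 2 Φ₀) (h2 : ContDiff ℝ 2 Φ₂) (h4 : ContDiff ℝ 2 Φ₄)
    (x : EuclideanSpace ℝ (Fin 3)) :
    Δ (zonalPressure Φ₀ Φ₂ Φ₄) x =
      (4 * ‖x‖ ^ 2 * deriv (deriv Φ₀) (‖x‖ ^ 2) + 6 * deriv Φ₀ (‖x‖ ^ 2))
        + (4 * ‖x‖ ^ 2 * deriv (deriv Φ₂) (‖x‖ ^ 2) + 14 * deriv Φ₂ (‖x‖ ^ 2)) * polyFun zonal2 x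
        + (4 * ‖x‖ ^ 2 * deriv (deriv Φ₄) (‖x‖ ^ 2) + 22 * deriv Φ₄ (‖x‖ ^ 2)) * polyFun zonal4 x := by
  -- the three shells, each `C²` at `x`
  have hA : ContDiffAt ℝ 2 (fun y : EuclideanSpace ℝ (Fin 3) => Φ₀ (‖y‖ ^ 2) * (fun _ => (1 : ℝ)) y) x :=
    contDiffAt_radial_mul (h0.contDiffAt) contDiffAt_const
  have hB : ContDiffAt ℝ 2 (fun y : EuclideanSpace ℝ (Fin 3) => Φ₂ (‖y‖ ^ 2) * polyFun zonal2 y) x :=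
    contDiffAt_radial_mul (h2.contDiffAt) contDiff_zonal2.contDiffAt
  have hC : ContDiffAt ℝ 2 (fun y : EuclideanSpace ℝ (Fin 3) => Φ₄ (‖y‖ ^ 2) * polyFun zonal4 y) x :=
    contDiffAt_radial_mul (h4.contDiffAt) contDiff_zonal4.contDiffAt
  have hAB : ContDiffAt ℝ 2 ((fun y : EuclideanSpace ℝ (Fin 3) => Φ₀ (‖y‖ ^ 2) * (fun _ => (1 : ℝ)) y) +
      fun y : EuclideanSpace ℝ (Fin 3) => Φ₂ (‖y‖ ^ 2) * polyFun zonal2 y) x := hA.add hB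
  rw [zonalPressure_eq, hAB.laplacian_add hC, hA.laplacian_add hB]
  -- shell by shell (plate R)
  have e0 : ⟪x, gradient (fun _ : EuclideanSpace ℝ (Fin 3) => (1 : ℝ)) x⟫ = 0 * (fun _ => (1 : ℝ)) x := by
    simp [gradient_fun_const]
  have hΔ1 : Δ (fun _ : EuclideanSpace ℝ (Fin 3) => (1 : ℝ)) x = 0 := by
    rw [laplacian_const]; rfl
  rw [laplacian_radial_mul 0 h0.contDiffAt contDiffAt_const hΔ1 e0,
    laplacian_radial_mul 2 h2.contDiffAt contDiff_zonal2.contDiffAt (laplacian_zonal2 x) (inner_gradient_zonal2 x),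
    laplacian_radial_mul 4 h4.contDiffAt contDiff_zonal4.contDiffAt (laplacian_zonal4 x) (inner_gradient_zonal4 x)]
  norm_num

/-- **Decay of the zonal pressure**: with `|Φ₀(s)| ≤ C/√s`, `|Φ₂(s)|·s ≤ C/√s`, `|Φ₄(s)|·s² ≤ C/√s` for `s ≥ 1`
(the exterior multipole bounds) and `|Z₂| ≤ 2‖x‖²`, `|Z₄| ≤ 35‖x‖⁴`: `|p(x)| ≤ 38C/‖x‖` for `‖x‖ ≥ 1`. -/
theorem abs_zonalPressure_le {C : ℝ} (hb0 : ∀ s, 1 ≤ s → |Φ₀ s| ≤ C / Real.sqrt s)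
    (hb2 : ∀ s, 1 ≤ s → |Φ₂ s| * s ≤ C / Real.sqrt s) (hb4 : ∀ s, 1 ≤ s → |Φ₄ s| * s ^ 2 ≤ C / Real.sqrt s)
    {x : EuclideanSpace ℝ (Fin 3)} (hx : 1 ≤ ‖x‖) : |zonalPressure Φ₀ Φ₂ Φ₄ x| ≤ 38 * C / ‖x‖ := by
  have hxpos : 0 < ‖x‖ := lt_of_lt_of_le one_pos hx
  have hs : 1 ≤ ‖x‖ ^ 2 := by nlinarith
  have hsqrt : Real.sqrt (‖x‖ ^ 2) = ‖x‖ := Real.sqrt_sq hxpos.le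
  have h0 := hb0 _ hs
  have h2 := hb2 _ hs
  have h4 := hb4 _ hs
  rw [hsqrt] at h0 h2 h4
  have hC : 0 ≤ C / ‖x‖ := le_trans (abs_nonneg _) h0
  have hZ2 := abs_polyFun_zonal2_le x
  have hZ4 := abs_polyFun_zonal4_le x
  -- `|Φ₂ Z₂| ≤ 2·(|Φ₂| s)`, `|Φ₄ Z₄| ≤ 35·(|Φ₄| s²)`
  have hT2 : |Φ₂ (‖x‖ ^ 2) * polyFun zonal2 x| ≤ 2 * (C / ‖x‖) := by
    rw [abs_mul]
    calc |Φ₂ (‖x‖ ^ 2)| * |polyFun zonal2 x| ≤ |Φ₂ (‖x‖ ^ 2)| * (2 * ‖x‖ ^ 2) :=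
          mul_le_mul_of_nonneg_left hZ2 (abs_nonneg _)
      _ = 2 * (|Φ₂ (‖x‖ ^ 2)| * ‖x‖ ^ 2) := by ring
      _ ≤ 2 * (C / ‖x‖) := by nlinarith
  have hT4 : |Φ₄ (‖x‖ ^ 2) * polyFun zonal4 x| ≤ 35 * (C / ‖x‖) := by
    rw [abs_mul]
    have h44 : ‖x‖ ^ 4 = (‖x‖ ^ 2) ^ 2 := by ring
    calc |Φ₄ (‖x‖ ^ 2)| * |polyFun zonal4 x| ≤ |Φ₄ (‖x‖ ^ 2)| * (35 * ‖x‖ ^ 4) :=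
          mul_le_mul_of_nonneg_left hZ4 (abs_nonneg _)
      _ = 35 * (|Φ₄ (‖x‖ ^ 2)| * (‖x‖ ^ 2) ^ 2) := by rw [h44]; ring
      _ ≤ 35 * (C / ‖x‖) := by nlinarith
  calc |zonalPressure Φ₀ Φ₂ Φ₄ x|
      ≤ |Φ₀ (‖x‖ ^ 2)| + |Φ₂ (‖x‖ ^ 2) * polyFun zonal2 x| + |Φ₄ (‖x‖ ^ 2) * polyFun zonal4 x| := by
        unfold zonalPressure
        exact abs_add_three _ _ _
    _ ≤ C / ‖x‖ + 2 * (C / ‖x‖) + 35 * (C / ‖x‖) := by linarith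
    _ = 38 * C / ‖x‖ := by ring

/-- **The zonal pressure tends to `0` at infinity** under the exterior multipole bounds. -/
theorem tendsto_zonalPressure_cocompact {C : ℝ} (hb0 : ∀ s, 1 ≤ s → |Φ₀ s| ≤ C / Real.sqrt s)
    (hb2 : ∀ s, 1 ≤ s → |Φ₂ s| * s ≤ C / Real.sqrt s) (hb4 : ∀ s, 1 ≤ s → |Φ₄ s| * s ^ 2 ≤ C / Real.sqrt s) :
    Tendsto (zonalPressure Φ₀ Φ₂ Φ₄) (cocompact (EuclideanSpace ℝ (Fin 3))) (𝓝 0) := by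
  have hnorm : Tendsto (fun x : EuclideanSpace ℝ (Fin 3) => ‖x‖) (cocompact _) atTop :=
    tendsto_norm_cocompact_atTop
  have hinv : Tendsto (fun x : EuclideanSpace ℝ (Fin 3) => 38 * C * ‖x‖⁻¹) (cocompact _) (𝓝 0) := by
    have := (tendsto_inv_atTop_zero.comp hnorm).const_mul (38 * C)
    simpa using this
  refine squeeze_zero_norm' ?_ hinv
  have hmem : (Metric.closedBall (0 : EuclideanSpace ℝ (Fin 3)) 1)ᶜ ∈ cocompact (EuclideanSpace ℝ (Fin 3)) :=
    (isCompact_closedBall (0 : EuclideanSpace ℝ (Fin 3)) 1).compl_mem_cocompact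
  filter_upwards [hmem] with x hx
  have hx1 : 1 ≤ ‖x‖ := by
    simp only [mem_compl_iff, Metric.mem_closedBall, dist_zero_right, not_le] at hx
    exact hx.le
  rw [Real.norm_eq_abs]
  have := abs_zonalPressure_le hb0 hb2 hb4 hx1
  rw [div_eq_mul_inv] at this
  exact this

/-- **Plate W2 (abstract): the zonal pressure is THE DECAYING PRESSURE of `u`** (`IsDecayingPressureOf`, Sketch45
verbatim) once (i) the profiles are `C²`, (ii) the three 1-D Poisson identities `4sΦ_l″ + (4l+6)Φ_l′ = F_l` hold for
`s ≥ 0`, (iii) the trace identity `−tr((∇u)²)(x) = F₀(‖x‖²) + F₂(‖x‖²)Z₂(x) + F₄(‖x‖²)Z₄(x)` holds at every `x`, and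
(iv) the exterior multipole bounds hold. -/
theorem isDecayingPressureOf_zonalPressure {u : EuclideanSpace ℝ (Fin 3) → EuclideanSpace ℝ (Fin 3)}
    {F₀ F₂ F₄ : ℝ → ℝ} {C : ℝ}
    (h0 : ContDiff ℝ 2 Φ₀) (h2 : ContDiff ℝ 2 Φ₂) (h4 : ContDiff ℝ 2 Φ₄)
    (hP0 : ∀ s, 0 ≤ s → 4 * s * deriv (deriv Φ₀) s + 6 * deriv Φ₀ s = F₀ s)
    (hP2 : ∀ s, 0 ≤ s → 4 * s * deriv (deriv Φ₂) s + 14 * deriv Φ₂ s = F₂ s)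
    (hP4 : ∀ s, 0 ≤ s → 4 * s * deriv (deriv Φ₄) s + 22 * deriv Φ₄ s = F₄ s)
    (hsrc : ∀ x : EuclideanSpace ℝ (Fin 3), -traceCLM ((fderiv ℝ u x).comp (fderiv ℝ u x)) =
      F₀ (‖x‖ ^ 2) + F₂ (‖x‖ ^ 2) * polyFun zonal2 x + F₄ (‖x‖ ^ 2) * polyFun zonal4 x)
    (hb0 : ∀ s, 1 ≤ s → |Φ₀ s| ≤ C / Real.sqrt s) (hb2 : ∀ s, 1 ≤ s → |Φ₂ s| * s ≤ C / Real.sqrt s)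
    (hb4 : ∀ s, 1 ≤ s → |Φ₄ s| * s ^ 2 ≤ C / Real.sqrt s) :
    IsDecayingPressureOf u (zonalPressure Φ₀ Φ₂ Φ₄) := by
  refine ⟨contDiff_two_zonalPressure h0 h2 h4, fun x => ?_, tendsto_zonalPressure_cocompact hb0 hb2 hb4⟩
  have hs : 0 ≤ ‖x‖ ^ 2 := by positivity
  rw [laplacian_zonalPressure h0 h2 h4 x, hP0 _ hs, hP2 _ hs, hP4 _ hs, hsrc x]

end

end IsotropicBlob

end Summit.NavierStokesRegularity.NavierStokesRegularity.Theorems.StrainDoors
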